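import Literature.Computability.AlgebraicComplexity.BLMW11ApproximationProjections
import Literature.Computability.AlgebraicComplexity.RegProgWellFormed
import HarnessLib

/-!
# Skew circuits are closed under affine substitution of the inputs (BLMW 2011, proof of
Prop. 9.3.2: "composing this circuit with an arithmetic circuit for matrix vector multiplication")

Bürgisser–Landsberg–Manivel–Weyman 2011, proof of Prop. 9.3.2 (arXiv:0907.2850, p. 21, first
direction): "There is a weakly-skew arithmetic circuit for `det_{m^c}` of size polynomial in `m`.
Composing this circuit with an arithmetic circuit for matrix vector multiplication that computes
the linear transformation `σ_k` yields a weakly-skew arithmetic circuit for `f_k = σ_k · det` of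
size at most `m^{c'}` … (In order to preserve the weak-skewness we may need several copies of the
circuit computing the linear transformation `σ_k`.)"

We formalise the composition step for SKEW circuits (every product gate has an input operand;
the tree's det circuit `HI16Skew.exists_wsCircuit_detPoly_wellFormed` is skew, and skew circuits
are weakly skew, `HI16Skew.exists_isWeaklySkew_of_isSkew`), where no copies are needed: a skew
product `β · x_v` becomes `∑_t A_{v,t} (β · x_t) + a_v β`, again skew. The construction is a
register program (`ArithCircuit.RegProg`, `HI16DetSkewCircuitProofs.lean`) over the gate indices
of the given circuit, compiled by rank.

* `ArithCircuit.SkewSubst.exists_skew_affineSubst` — **main construction**: for a fan-in-two skew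
  circuit `P` over variables `σ` and affine forms `ψ_v = a_v + ∑_t A_{v,t} x_t` (`v : σ`, `t : τ`),
  a WELL-FORMED fan-in-two skew circuit computing `P.eval(ψ)` of size
  `≤ (P.size + #σ) · (2 #τ + 3)`.
* `skewComplexity_aeval_affine_le`, `wsComplexity_aeval_affine_le`, `wsComplexity_linSubst_le` —
  the complexity bounds; `wsComplexity_linSubst_detPoly_le` — **every `A · det_M`
  (`A ∈ Mat_{M²×M²}`) has `L_ws ≤ ((M+2)(4M³+7)² + M²)(2M²+3)`**, the printed "weakly-skew
  arithmetic circuit for `f_k` of size at most `m^{c'}`".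

Cell `val-lit`, seat t14, step (P3) of the discharge of `BLMW2011_prop_9_3_2`. The register
type and the program are definitions (plumbing); no named facts.

## References
* [BLMW 2011] SIAM J. Comput. 40 (2011), proof of Prop. 9.3.2 (arXiv Prop. 9.2, p. 21).
  Bib key `BurgisserEtAl2011`.
* [Bürgisser 2000] P. Bürgisser, *Completeness and Reduction in Algebraic Complexity Theory*,
  Def. 2.1 / Rem. 2.2 (straight-line programs, substitution). Bib key `Burgisser2000`.
-/

noncomputable section

open MvPolynomial

namespace Literature.Computability.AlgebraicComplexity

namespace ArithCircuit

universe u v w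

/-! ### The register program of an affine input substitution into a skew circuit -/

namespace SkewSubst

/-- Registers: `lin v i` = `i`-th partial sum of the affine form `ψ_v`; `main j` = value of gate `j`
of `P` after substitution; `px j i` = (left operand of product gate `j`) `· x_{t_i}`; `ps j i` =
`i`-th partial sum of (left operand) `· ψ_w` for a product gate `j = (left) · x_w`.
[cite: BurgisserEtAl2011, §9.3 (proof of Prop. 9.3.2, first direction)] -/
inductive Reg (σ : Type v) : Type v
  /-- `i`-th partial sum of the affine form substituted for `x_v`. -/
  | lin (v : σ) (i : ℕ) : Reg σ
  /-- the value of gate `j` after substitution. -/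
  | main (j : ℕ) : Reg σ
  /-- left operand of product gate `j` times the `i`-th new variable. -/
  | px (j i : ℕ) : Reg σ
  /-- `i`-th partial sum assembling product gate `j`. -/
  | ps (j i : ℕ) : Reg σ
  deriving DecidableEq

variable {k : Type u} [CommSemiring k] {σ : Type v} {τ : Type w}
variable [Fintype σ] [Fintype τ]
variable (P : ArithCircuit k σ) (a0 : σ → k) (A : σ → τ → k)

/-- The affine form `ψ_v = a_v + ∑_t A_{v,t} x_t` substituted for `x_v`.
[cite: BurgisserEtAl2011, §9.3 (proof of Prop. 9.3.2, first direction)] -/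
def psi (v : σ) : MvPolynomial τ k :=
  C (a0 v) + ∑ t, A v t • X t

/-- The `i`-th variable of `τ` in a fixed enumeration. [cite: Burgisser2000, Def. 2.1] -/
def tAt (i : ℕ) (h : i < Fintype.card τ) : τ :=
  (Fintype.equivFin τ).symm ⟨i, h⟩

/-- Translation of an operand of gate `i` of `P` to a register operand: a variable `x_v` becomes the
register holding `ψ_v`, a (non-junk) gate reference `j < i` the register `main j`, a junk
reference the constant `0` (its value). [cite: Burgisser2000, Def. 2.1] -/
def opnd (i : ℕ) : Operand k σ → ROperand k τ (Reg σ)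
  | .var v => .reg (.lin v (Fintype.card τ))
  | .const c => .const c
  | .gate j => if j < i then .reg (.main j) else .const 0

/-- The (left, right) operands of a fan-in-two product gate, the right one being an input operand
whenever the gate is skew; `(0, 0)` for other gates. [cite: BurgisserEtAl2011, §9.4 (skew circuits)] -/
def leftRight : Option (Gate k σ) → Operand k σ × Operand k σ
  | some (.prod [u1, u2]) => if u2.isGateRef = false then (u1, u2) else (u2, u1)
  | _ => (.const 0, .const 0)

/-- The left operand of product gate `j`. [cite: BurgisserEtAl2011, §9.4 (skew circuits)] -/
def left (j : ℕ) : Operand k σ := (leftRight P.gates[j]?).1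

/-- The right (input) operand of product gate `j`. [cite: BurgisserEtAl2011, §9.4 (skew circuits)] -/
def right (j : ℕ) : Operand k σ := (leftRight P.gates[j]?).2

/-- The substitution homomorphism `f ↦ f(ψ)`. [cite: BurgisserEtAl2011, §9.3 (proof of Prop. 9.3.2, first direction)] -/
noncomputable def Psi : MvPolynomial σ k →ₐ[k] MvPolynomial τ k :=
  aeval (psi a0 A)

/-- `i`-th partial sum of `ψ_v`. [cite: BurgisserEtAl2011, §9.3 (proof of Prop. 9.3.2, first direction)] -/
noncomputable def linVal (v : σ) : ℕ → MvPolynomial τ k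
  | 0 => C (a0 v)
  | i + 1 => linVal v i +
      if h : i < Fintype.card τ then A v (tAt i h) • X (tAt i h) else 0

/-- `i`-th partial sum of `L · ψ_w` for a given left factor `L`.
[cite: BurgisserEtAl2011, §9.3 (proof of Prop. 9.3.2, first direction)] -/
noncomputable def psVal (L : MvPolynomial τ k) (w : σ) : ℕ → MvPolynomial τ k
  | 0 => a0 w • L
  | i + 1 => psVal L w i +
      if h : i < Fintype.card τ then A w (tAt i h) • (L * X (tAt i h)) else 0

/-- The intended values of the registers. [cite: BurgisserEtAl2011, §9.3 (proof of Prop. 9.3.2, first direction)] -/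
noncomputable def val : Reg σ → MvPolynomial τ k
  | .lin v i => linVal a0 A v i
  | .main j => Psi a0 A (P.gateVal j)
  | .px j i => if h : i < Fintype.card τ then
      Psi a0 A (P.opVal j (left P j)) * X (tAt i h) else 1
  | .ps j i => match right P j with
    | .var w => psVal a0 A (Psi a0 A (P.opVal j (left P j))) w i
    | _ => 0

/-- The defining gate of register `main j`, by cases on gate `j` of `P`.
[cite: BurgisserEtAl2011, §9.3 (proof of Prop. 9.3.2, first direction)] -/
def mainGate (j : ℕ) : Option (Gate k σ) → RGate k τ (Reg σ)
  | none => .sum []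
  | some (.sum args) => .sum (args.map fun a => (a.1, opnd j a.2))
  | some (.prod []) => .prod []
  | some (.prod [u]) => .sum [(1, opnd j u)]
  | some (.prod [_, _]) => match right P j with
    | .const c => .prod [opnd j (left P j), .const c]
    | .var _ => .sum [(1, .reg (.ps j (Fintype.card τ)))]
    | .gate _ => .sum []
  | some (.prod (_ :: _ :: _ :: _)) => .sum []

/-- The defining gates of the registers. [cite: BurgisserEtAl2011, §9.3 (proof of Prop. 9.3.2, first direction)] -/
def gateOf : Reg σ → RGate k τ (Reg σ)
  | .lin v 0 => .sum [(a0 v, .const 1)]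
  | .lin v (i + 1) => if h : i < Fintype.card τ then
      .sum [(1, .reg (.lin v i)), (A v (tAt i h), .var (tAt i h))]
    else .sum [(1, .reg (.lin v i))]
  | .main j => mainGate P j P.gates[j]?
  | .px j i => if h : i < Fintype.card τ then
      .prod [opnd j (left P j), .var (tAt i h)] else .prod []
  | .ps j 0 => match right P j with
    | .var w => .sum [(a0 w, opnd j (left P j))]
    | _ => .sum []
  | .ps j (i + 1) => match right P j with
    | .var w => if h : i < Fintype.card τ then
        .sum [(1, .reg (.ps j i)), (A w (tAt i h), .reg (.px j i))]
      else .sum [(1, .reg (.ps j i))]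
    | _ => .sum []

/-- Base rank of the block of registers of gate `j`. [cite: Burgisser2000, Def. 2.1] -/
def base (j : ℕ) : ℕ := Fintype.card τ + 1 + j * (Fintype.card τ + 3)

/-- Ranks: the `lin` chains first, then one block per gate of `P` in order.
[cite: Burgisser2000, Def. 2.1] -/
def rank : Reg σ → ℕ
  | .lin _ i => i
  | .main j => base (τ := τ) j + Fintype.card τ + 2
  | .px j _ => base (τ := τ) j
  | .ps j i => base (τ := τ) j + 1 + i

/-- The registers of the program. [cite: Burgisser2000, Def. 2.1] -/
def regs : List (Reg σ) :=
  ((Finset.univ : Finset σ).toList.flatMap fun v =>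
      (List.range (Fintype.card τ + 1)).map fun i => Reg.lin v i) ++
    (List.range P.size).flatMap fun j =>
      [Reg.main j] ++ ((List.range (Fintype.card τ)).map fun i => Reg.px j i) ++
        ((List.range (Fintype.card τ + 1)).map fun i => Reg.ps j i)

/-- The register program of the substitution `P(ψ)`. [cite: BurgisserEtAl2011, §9.3 (proof of Prop. 9.3.2, first direction)] -/
def prog : RegProg k τ (Reg σ) where
  regs := regs (τ := τ) P
  rank := rank (τ := τ)
  gateOf := gateOf P a0 A
  output := opnd P.size P.output

/-! #### Membership and ranks -/

omit [CommSemiring k] in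
/-- Membership of the `lin` registers. [cite: Burgisser2000, Def. 2.1] -/
theorem mem_regs_lin {v : σ} {i : ℕ} :
    Reg.lin v i ∈ regs (τ := τ) P ↔ i ≤ Fintype.card τ := by
  simp [regs]

omit [CommSemiring k] in
/-- Membership of the `main` registers. [cite: Burgisser2000, Def. 2.1] -/
theorem mem_regs_main {j : ℕ} : Reg.main j ∈ regs (τ := τ) P ↔ j < P.size := by
  simp [regs]

omit [CommSemiring k] in
/-- Membership of the `px` registers. [cite: Burgisser2000, Def. 2.1] -/
theorem mem_regs_px {j i : ℕ} :
    Reg.px j i ∈ regs (τ := τ) P ↔ j < P.size ∧ i < Fintype.card τ := by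
  simp [regs]

omit [CommSemiring k] in
/-- Membership of the `ps` registers. [cite: Burgisser2000, Def. 2.1] -/
theorem mem_regs_ps {j i : ℕ} :
    Reg.ps j i ∈ regs (τ := τ) P ↔ j < P.size ∧ i ≤ Fintype.card τ := by
  simp [regs]

omit [Fintype σ] in
/-- Consecutive blocks of ranks are `#τ + 3` apart. [cite: Burgisser2000, Def. 2.1] -/
theorem base_succ_le {j j' : ℕ} (h : j' < j) :
    base (τ := τ) j' + Fintype.card τ + 3 ≤ base (τ := τ) j := by
  unfold base
  have : (j' + 1) * (Fintype.card τ + 3) ≤ j * (Fintype.card τ + 3) :=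
    Nat.mul_le_mul_right _ h
  rw [Nat.succ_mul] at this
  omega

/-- The registers read by a translated operand of gate `j ≤ P.size` are registers of the program,
of rank `< base j`. [cite: Burgisser2000, Def. 2.1] -/
theorem reads_opnd {j : ℕ} (hj : j ≤ P.size) (u : Operand k σ) :
    ∀ r' ∈ (opnd (τ := τ) j u).reads, r' ∈ regs (τ := τ) P ∧ rank (τ := τ) r' < base (τ := τ) j := by
  intro r' hr'
  cases u with
  | var v =>
    simp only [opnd, ROperand.reads, List.mem_singleton] at hr'
    subst hr'
    refine ⟨(mem_regs_lin P).2 le_rfl, ?_⟩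
    simp only [rank, base]
    omega
  | const c => simp [opnd, ROperand.reads] at hr'
  | gate j' =>
    by_cases hjj : j' < j
    · simp only [opnd, if_pos hjj, ROperand.reads, List.mem_singleton] at hr'
      subst hr'
      refine ⟨(mem_regs_main P).2 (lt_of_lt_of_le hjj hj), ?_⟩
      have := base_succ_le (τ := τ) hjj
      simp only [rank]
      omega
    · simp [opnd, if_neg hjj, ROperand.reads] at hr'


/-! #### Well-rankedness -/

/-- **The substitution program is well ranked.** [cite: Burgisser2000, Def. 2.1] -/
theorem wellRanked : (prog P a0 A).WellRanked := by
  intro r hr r' hr'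
  change r ∈ regs (τ := τ) P at hr
  change r' ∈ (gateOf P a0 A r).reads at hr'
  change r' ∈ regs (τ := τ) P ∧ rank (τ := τ) r' < rank (τ := τ) r
  cases r with
  | lin v i =>
    have hi := (mem_regs_lin P).1 hr
    cases i with
    | zero => simp [gateOf, RGate.reads, ROperand.reads] at hr'
    | succ i =>
      by_cases h : i < Fintype.card τ
      · simp only [gateOf, dif_pos h, RGate.reads, List.flatMap_cons, List.flatMap_nil,
          ROperand.reads, List.append_nil, List.mem_singleton] at hr'
        subst hr'
        exact ⟨(mem_regs_lin P).2 (by omega), by simp [rank]⟩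
      · simp only [gateOf, dif_neg h, RGate.reads, List.flatMap_cons, List.flatMap_nil,
          ROperand.reads, List.append_nil, List.mem_singleton] at hr'
        subst hr'
        exact ⟨(mem_regs_lin P).2 (by omega), by simp [rank]⟩
  | main j =>
    have hj := (mem_regs_main P).1 hr
    have hmain : ∀ u : Operand k σ, r' ∈ (opnd (τ := τ) j u).reads →
        r' ∈ regs (τ := τ) P ∧ rank (τ := τ) r' < rank (τ := τ) (Reg.main j : Reg σ) := by
      intro u hu
      obtain ⟨h1, h2⟩ := reads_opnd P hj.le u r' hu
      refine ⟨h1, ?_⟩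
      change rank (τ := τ) r' < base (τ := τ) j + Fintype.card τ + 2
      omega
    simp only [gateOf] at hr'
    rcases hg : P.gates[j]? with _ | ⟨args⟩ | ⟨args⟩ <;> rw [hg] at hr'
    · simp [mainGate, RGate.reads] at hr'
    · simp only [mainGate, RGate.reads, List.mem_flatMap, List.mem_map] at hr'
      obtain ⟨_, ⟨a, ha, rfl⟩, hr'⟩ := hr'
      exact hmain a.2 hr'
    · rcases args with _ | ⟨u, _ | ⟨u2, _ | ⟨u3, rest⟩⟩⟩
      · simp [mainGate, RGate.reads] at hr'
      · simp only [mainGate, RGate.reads, List.flatMap_cons, List.flatMap_nil, List.append_nil] at hr'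
        exact hmain u hr'
      · cases hrt : right P j with
        | var w =>
          simp only [mainGate, hrt, RGate.reads, List.flatMap_cons, List.flatMap_nil,
            ROperand.reads, List.append_nil, List.mem_singleton] at hr'
          subst hr'
          exact ⟨(mem_regs_ps P).2 ⟨hj, le_rfl⟩, by simp only [rank]; omega⟩
        | const c =>
          simp only [mainGate, hrt, RGate.reads, List.flatMap_cons, List.flatMap_nil,
            ROperand.reads, List.append_nil] at hr'
          exact hmain _ hr'
        | gate j'' => simp [mainGate, hrt, RGate.reads] at hr'
      · simp [mainGate, RGate.reads] at hr'
  | px j i =>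
    obtain ⟨hj, hi⟩ := (mem_regs_px P).1 hr
    simp only [gateOf, dif_pos hi, RGate.reads, List.flatMap_cons, List.flatMap_nil,
      ROperand.reads, List.append_nil] at hr'
    obtain ⟨h1, h2⟩ := reads_opnd P hj.le _ r' hr'
    exact ⟨h1, h2⟩
  | ps j i =>
    obtain ⟨hj, hi⟩ := (mem_regs_ps P).1 hr
    cases i with
    | zero =>
      cases hrt : right P j with
      | var w =>
        simp only [gateOf, hrt, RGate.reads, List.flatMap_cons, List.flatMap_nil,
          List.append_nil] at hr'
        obtain ⟨h1, h2⟩ := reads_opnd P hj.le _ r' hr'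
        refine ⟨h1, ?_⟩
        change rank (τ := τ) r' < base (τ := τ) j + 1 + 0
        omega
      | const c => simp [gateOf, hrt, RGate.reads] at hr'
      | gate j'' => simp [gateOf, hrt, RGate.reads] at hr'
    | succ i =>
      cases hrt : right P j with
      | var w =>
        have h : i < Fintype.card τ := by omega
        simp [gateOf, hrt, dif_pos h, RGate.reads, ROperand.reads] at hr'
        rcases hr' with rfl | rfl
        · exact ⟨(mem_regs_ps P).2 ⟨hj, by omega⟩, by simp [rank]⟩
        · exact ⟨(mem_regs_px P).2 ⟨hj, h⟩, by simp [rank]; omega⟩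
      | const c => simp [gateOf, hrt, RGate.reads] at hr'
      | gate j'' => simp [gateOf, hrt, RGate.reads] at hr'

/-! #### Fan-in and skewness of the gates -/

omit [CommSemiring k] [Fintype σ] [Fintype τ] in
/-- A pair `[a, input]` of register operands has at most one register reference.
[cite: BurgisserEtAl2011, §9.4 (skew circuits)] -/
theorem countP_pair_le_one (a b : ROperand k τ (Reg σ)) (hb : b.isRegRef = false) :
    [a, b].countP ROperand.isRegRef ≤ 1 := by
  cases a <;> cases b <;> simp_all [ROperand.isRegRef]

omit [Fintype σ] in
/-- Every gate of the substitution program has fan-in at most two (if `P` has).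
[cite: Burgisser2000, Def. 2.1] -/
theorem fanIn_gateOf_le (h2 : P.IsFanInTwo) (r : Reg σ) : (gateOf P a0 A r).fanIn ≤ 2 := by
  cases r with
  | lin v i =>
    cases i with
    | zero => simp [gateOf, RGate.fanIn]
    | succ i =>
      by_cases h : i < Fintype.card τ
      · simp [gateOf, dif_pos h, RGate.fanIn]
      · simp [gateOf, dif_neg h, RGate.fanIn]
  | main j =>
    simp only [gateOf]
    rcases hg : P.gates[j]? with _ | ⟨args⟩ | ⟨args⟩
    · simp [mainGate, RGate.fanIn]
    · simp only [mainGate, RGate.fanIn, List.length_map]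
      simpa [Gate.fanIn, Gate.args] using h2 _ (List.mem_of_getElem? hg)
    · rcases args with _ | ⟨u, _ | ⟨u2, _ | ⟨u3, rest⟩⟩⟩
      · simp [mainGate, RGate.fanIn]
      · simp [mainGate, RGate.fanIn]
      · cases hrt : right P j <;> simp [mainGate, hrt, RGate.fanIn]
      · simp [mainGate, RGate.fanIn]
  | px j i =>
    by_cases h : i < Fintype.card τ
    · simp [gateOf, dif_pos h, RGate.fanIn]
    · simp [gateOf, dif_neg h, RGate.fanIn]
  | ps j i =>
    cases i with
    | zero => cases hrt : right P j <;> simp [gateOf, hrt, RGate.fanIn]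
    | succ i =>
      cases hrt : right P j with
      | var w =>
        by_cases h : i < Fintype.card τ
        · simp [gateOf, hrt, dif_pos h, RGate.fanIn]
        · simp [gateOf, hrt, dif_neg h, RGate.fanIn]
      | const c => simp [gateOf, hrt, RGate.fanIn]
      | gate j'' => simp [gateOf, hrt, RGate.fanIn]

omit [Fintype σ] in
/-- **Every gate of the substitution program is skew**: its product gates are
`(left) · x_t`, `(left) · c` and the empty product. [cite: BurgisserEtAl2011, §9.4 (skew circuits)] -/
theorem isSkew_gateOf (r : Reg σ) : (gateOf P a0 A r).IsSkew := by
  cases r with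
  | lin v i =>
    cases i with
    | zero => simp [gateOf, RGate.IsSkew]
    | succ i =>
      by_cases h : i < Fintype.card τ
      · simp [gateOf, dif_pos h, RGate.IsSkew]
      · simp [gateOf, dif_neg h, RGate.IsSkew]
  | main j =>
    simp only [gateOf]
    rcases hg : P.gates[j]? with _ | ⟨args⟩ | ⟨args⟩
    · simp [mainGate, RGate.IsSkew]
    · simp [mainGate, RGate.IsSkew]
    · rcases args with _ | ⟨u, _ | ⟨u2, _ | ⟨u3, rest⟩⟩⟩
      · simp [mainGate, RGate.IsSkew]
      · simp [mainGate, RGate.IsSkew]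
      · cases hrt : right P j with
        | var w => simp [mainGate, hrt, RGate.IsSkew]
        | const c =>
          simp only [mainGate, hrt, RGate.IsSkew]
          exact countP_pair_le_one _ _ rfl
        | gate j'' => simp [mainGate, hrt, RGate.IsSkew]
      · simp [mainGate, RGate.IsSkew]
  | px j i =>
    by_cases h : i < Fintype.card τ
    · simp only [gateOf, dif_pos h, RGate.IsSkew]
      exact countP_pair_le_one _ _ rfl
    · simp [gateOf, dif_neg h, RGate.IsSkew]
  | ps j i =>
    cases i with
    | zero => cases hrt : right P j <;> simp [gateOf, hrt, RGate.IsSkew]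
    | succ i =>
      cases hrt : right P j with
      | var w =>
        by_cases h : i < Fintype.card τ
        · simp [gateOf, hrt, dif_pos h, RGate.IsSkew]
        · simp [gateOf, hrt, dif_neg h, RGate.IsSkew]
      | const c => simp [gateOf, hrt, RGate.IsSkew]
      | gate j'' => simp [gateOf, hrt, RGate.IsSkew]

/-! #### Values -/

omit [Fintype σ] in
/-- Closed form of the partial sums of `ψ_v`. [cite: BurgisserEtAl2011, §9.3 (proof of Prop. 9.3.2, first direction)] -/
theorem linVal_eq (v : σ) (i : ℕ) :
    linVal (τ := τ) a0 A v i = C (a0 v) + ∑ m ∈ Finset.range i,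
      (if h : m < Fintype.card τ then A v (tAt m h) • (X (tAt m h) : MvPolynomial τ k) else 0) := by
  induction i with
  | zero => simp [linVal]
  | succ i ih => rw [linVal, ih, Finset.sum_range_succ, add_assoc]

omit [Fintype σ] in
/-- The full partial sum is `ψ_v`. [cite: BurgisserEtAl2011, §9.3 (proof of Prop. 9.3.2, first direction)] -/
theorem linVal_card (v : σ) : linVal (τ := τ) a0 A v (Fintype.card τ) = psi a0 A v := by
  rw [linVal_eq, psi, ← Fin.sum_univ_eq_sum_range]
  congr 1
  rw [← Equiv.sum_comp (Fintype.equivFin τ).symm]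
  refine Finset.sum_congr rfl fun m _ => ?_
  rw [dif_pos m.isLt]
  rfl

omit [Fintype σ] in
/-- Closed form of the partial sums of `L · ψ_w`. [cite: BurgisserEtAl2011, §9.3 (proof of Prop. 9.3.2, first direction)] -/
theorem psVal_eq (L : MvPolynomial τ k) (w : σ) (i : ℕ) :
    psVal (τ := τ) a0 A L w i = a0 w • L + ∑ m ∈ Finset.range i,
      (if h : m < Fintype.card τ then A w (tAt m h) • (L * X (tAt m h)) else 0) := by
  induction i with
  | zero => simp [psVal]
  | succ i ih => rw [psVal, ih, Finset.sum_range_succ, add_assoc]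

omit [Fintype σ] in
/-- The full partial sum is `L · ψ_w`. [cite: BurgisserEtAl2011, §9.3 (proof of Prop. 9.3.2, first direction)] -/
theorem psVal_card (L : MvPolynomial τ k) (w : σ) :
    psVal (τ := τ) a0 A L w (Fintype.card τ) = L * psi a0 A w := by
  rw [psVal_eq, psi, ← Fin.sum_univ_eq_sum_range, mul_add, Finset.mul_sum]
  congr 1
  · rw [smul_eq_C_mul, mul_comm]
  · rw [← Equiv.sum_comp (Fintype.equivFin τ).symm]
    refine Finset.sum_congr rfl fun m _ => ?_
    rw [dif_pos m.isLt, mul_smul_comm]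
    rfl

omit [Fintype σ] in
/-- **Translated operands denote substituted operand values.** [cite: Burgisser2000, Rem. 2.2] -/
theorem eval_opnd (j : ℕ) (u : Operand k σ) :
    (opnd (τ := τ) j u).eval (val P a0 A) = Psi a0 A (P.opVal j u) := by
  cases u with
  | var v => simp [opnd, ROperand.eval, val, linVal_card, Psi, ArithCircuit.opVal_var]
  | const c => simp [opnd, ROperand.eval, Psi, ArithCircuit.opVal_const]
  | gate j' =>
    by_cases h : j' < j
    · simp [opnd, h, ROperand.eval, val, ArithCircuit.opVal_gate]
    · simp [opnd, h, ROperand.eval, ArithCircuit.opVal_gate]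

omit [Fintype σ] in
/-- For a fan-in-two product gate `j = u₁ · u₂`: `(left)·(right) = u₁ · u₂` after substitution.
[cite: BurgisserEtAl2011, §9.4 (skew circuits)] -/
theorem left_mul_right {j : ℕ} {u1 u2 : Operand k σ} (hg : P.gates[j]? = some (.prod [u1, u2])) :
    Psi a0 A (P.opVal j (left P j)) * Psi a0 A (P.opVal j (right P j)) =
      Psi a0 A (P.opVal j u1) * Psi a0 A (P.opVal j u2) := by
  unfold left right leftRight
  rw [hg]
  simp only
  split_ifs
  · rfl
  · exact mul_comm _ _

omit [Fintype σ] [Fintype τ] in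
/-- For a SKEW fan-in-two product gate the chosen right operand is an input operand.
[cite: BurgisserEtAl2011, §9.4 (skew circuits)] -/
theorem isGateRef_right {j : ℕ} {u1 u2 : Operand k σ} (hg : P.gates[j]? = some (.prod [u1, u2]))
    (hs : (Gate.prod [u1, u2]).IsSkew) : (right P j).isGateRef = false := by
  unfold right leftRight
  rw [hg]
  simp only
  split_ifs with hu2
  · exact hu2
  · -- both operands cannot be gate references in a skew gate
    cases u1 with
    | var v => rfl
    | const c => rfl
    | gate j1 =>
      exfalso
      cases u2 with
      | var v => exact hu2 rfl
      | const c => exact hu2 rfl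
      | gate j2 => simp [Gate.IsSkew, Operand.isGateRef] at hs

/-- **The intended values realize the substitution program** (the local equations, gate by gate:
sums map to sums, a skew product `u · x_w` to `∑_t A_{w,t}(u · x_t) + a_w u`, `u · c` to `u · c`).
[cite: BurgisserEtAl2011, §9.3 (proof of Prop. 9.3.2, first direction)] -/
theorem realizes (h2 : P.IsFanInTwo) (hsk : P.IsSkew) : (prog P a0 A).Realizes (val P a0 A) := by
  intro r
  change (gateOf P a0 A r).eval (val P a0 A) = val P a0 A r
  cases r with
  | lin v i =>
    cases i with
    | zero => simp [gateOf, RGate.eval, val, linVal, smul_eq_C_mul]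
    | succ i =>
      by_cases h : i < Fintype.card τ
      · simp [gateOf, dif_pos h, RGate.eval, val, linVal]
      · simp [gateOf, dif_neg h, RGate.eval, val, linVal]
  | main j =>
    simp only [gateOf, val]
    rcases hg : P.gates[j]? with _ | ⟨args⟩ | ⟨args⟩
    · have hj : P.size ≤ j := by
        simpa [ArithCircuit.size] using List.getElem?_eq_none_iff.mp hg
      simp [mainGate, RGate.eval, P.gateVal_of_le hj]
    · rw [P.gateVal_of_sum hg, map_list_sum]
      simp only [mainGate, RGate.eval, List.map_map]
      congr 1
      refine List.map_congr_left fun a _ => ?_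
      simp only [Function.comp_apply, map_smul, eval_opnd]
    · have hmem : Gate.prod args ∈ P.gates := List.mem_of_getElem? hg
      rcases args with _ | ⟨u, _ | ⟨u2, _ | ⟨u3, rest⟩⟩⟩
      · simp [mainGate, RGate.eval, P.gateVal_of_prod hg]
      · simp [mainGate, RGate.eval, P.gateVal_of_prod hg, eval_opnd]
      · have hprod : Psi a0 A (P.gateVal j) =
            Psi a0 A (P.opVal j (left P j)) * Psi a0 A (P.opVal j (right P j)) := by
          rw [P.gateVal_of_prod hg, left_mul_right P a0 A hg]
          simp [map_mul]
        have hright := isGateRef_right P hg (hsk _ hmem)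
        cases hrt : right P j with
        | var w =>
          rw [hprod, hrt]
          simp [mainGate, hrt, RGate.eval, val, psVal_card, Psi]
        | const c =>
          rw [hprod, hrt]
          simp [mainGate, hrt, RGate.eval, eval_opnd, Psi]
        | gate j'' =>
          rw [hrt] at hright
          simp [Operand.isGateRef] at hright
      · have := h2 _ hmem
        simp [Gate.fanIn, Gate.args] at this
  | px j i =>
    by_cases h : i < Fintype.card τ
    · simp [gateOf, dif_pos h, RGate.eval, val, eval_opnd]
    · simp [gateOf, dif_neg h, RGate.eval, val]
  | ps j i =>
    cases i with
    | zero =>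
      cases hrt : right P j with
      | var w => simp [gateOf, hrt, RGate.eval, val, psVal, eval_opnd]
      | const c => simp [gateOf, hrt, RGate.eval, val]
      | gate j'' => simp [gateOf, hrt, RGate.eval, val]
    | succ i =>
      cases hrt : right P j with
      | var w =>
        by_cases h : i < Fintype.card τ
        · simp [gateOf, hrt, dif_pos h, RGate.eval, val, psVal]
        · simp [gateOf, hrt, dif_neg h, RGate.eval, val, psVal]
      | const c => simp [gateOf, hrt, RGate.eval, val]
      | gate j'' => simp [gateOf, hrt, RGate.eval, val]

/-! #### Size -/

omit [CommSemiring k] [Fintype σ] [Fintype τ] in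
/-- Length of a `flatMap` with blocks of constant length. [cite: Burgisser2000, Def. 2.1] -/
private theorem length_flatMap_of_const {α β : Type*} (l : List α) (f : α → List β) (c : ℕ)
    (h : ∀ a ∈ l, (f a).length = c) : (l.flatMap f).length = l.length * c := by
  induction l with
  | nil => simp
  | cons x xs ih =>
    rw [List.flatMap_cons, List.length_append, h x (by simp), ih fun a ha => h a (by simp [ha]),
      List.length_cons]
    ring

omit [CommSemiring k] in
/-- **Size of the substitution program**: `#σ (#τ + 1) + |P| (2 #τ + 2) ≤ (|P| + #σ)(2 #τ + 3)`
registers. [cite: BurgisserEtAl2011, §9.3 (proof of Prop. 9.3.2, first direction)] -/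
theorem length_regs_le :
    (regs (τ := τ) P).length ≤ (P.size + Fintype.card σ) * (2 * Fintype.card τ + 3) := by
  unfold regs
  rw [List.length_append,
    length_flatMap_of_const _ _ (Fintype.card τ + 1) (fun a _ => by simp),
    length_flatMap_of_const _ _ (2 * Fintype.card τ + 2) (fun a _ => by simp; ring),
    Finset.length_toList, Finset.card_univ, List.length_range]
  nlinarith

/-! #### The theorem -/

/-- **Skew circuits are closed under affine substitution of the inputs** (BLMW 2011, proof of
Prop. 9.3.2, first direction: "composing this circuit with an arithmetic circuit for matrix
vector multiplication …" — for skew circuits no copies are needed). For a fan-in-two skew circuit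
`P` in the variables `σ` and affine forms `ψ_v = a_v + ∑_t A_{v,t} x_t` in the variables `τ`
there is a WELL-FORMED fan-in-two skew circuit computing `P.eval(ψ)` with at most
`(|P| + #σ)(2 #τ + 3)` gates (compile the register program `prog`).
[cite: BurgisserEtAl2011, Prop. 9.3.2 (proof, first direction)] -/
theorem exists_skew_affineSubst [DecidableEq σ] (h2 : P.IsFanInTwo) (hsk : P.IsSkew) :
    ∃ Q : ArithCircuit k τ, Q.WellFormed ∧ Q.IsFanInTwo ∧ Q.IsSkew ∧
      Q.eval = aeval (psi a0 A) P.eval ∧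
      Q.size ≤ (P.size + Fintype.card σ) * (2 * Fintype.card τ + 3) := by
  have hout : ∀ r' ∈ (prog P a0 A).output.reads, r' ∈ (prog P a0 A).regs :=
    fun r' hr' => (reads_opnd P le_rfl P.output r' hr').1
  refine ⟨(prog P a0 A).compile,
    RegProg.wellFormed_compile _ (wellRanked P a0 A) hout,
    RegProg.isFanInTwo_compile _ (fun r _ => fanIn_gateOf_le P a0 A h2 r),
    RegProg.isSkew_compile _ (fun r _ => isSkew_gateOf P a0 A r), ?_, ?_⟩
  · rw [RegProg.eval_compile _ (wellRanked P a0 A) (realizes P a0 A h2 hsk) hout]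
    change (opnd (τ := τ) P.size P.output).eval (val P a0 A) = _
    rw [eval_opnd, ArithCircuit.eval_eq_opVal_output]
    rfl
  · rw [RegProg.size_compile]
    exact length_regs_le P

end SkewSubst

end ArithCircuit

/-! ### Complexity bounds -/

section Bounds

open ArithCircuit

variable {k : Type*} [CommSemiring k] {σ τ : Type*} [Fintype σ] [DecidableEq σ] [Fintype τ]

/-- **Skew complexity under affine substitution**: `L_skew(f(ψ)) ≤ (L_skew(f) + #σ)(2 #τ + 3)`
(corrected, well-formed notion). [cite: BurgisserEtAl2011, Prop. 9.3.2 (proof, first direction)] -/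
theorem skewComplexity_aeval_affine_le (a0 : σ → k) (A : σ → τ → k) (f : MvPolynomial σ k) :
    skewComplexity (aeval (SkewSubst.psi a0 A) f) ≤
      (skewComplexity f + Fintype.card σ) * (2 * Fintype.card τ + 3) := by
  obtain ⟨P, _, h2, hsk, hc, hsz⟩ := HI16Skew.skewComplexity_attained f
  obtain ⟨Q, hq1, hq2, hq3, hq4, hq5⟩ := SkewSubst.exists_skew_affineSubst P a0 A h2 hsk
  rw [ArithCircuit.Computes] at hc
  rw [hc] at hq4
  rw [← hsz]
  exact (skewComplexity_le_size (f := aeval (SkewSubst.psi a0 A) f) Q hq1 hq2 hq3 hq4).trans hq5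

/-- **Weakly-skew complexity under affine substitution** (through skew circuits, which are weakly
skew, `HI16Skew.wsComplexity_le_skewComplexity`):
`L_ws(f(ψ)) ≤ (L_skew(f) + #σ)(2 #τ + 3)`. [cite: BurgisserEtAl2011, Prop. 9.3.2 (proof, first direction)] -/
theorem wsComplexity_aeval_affine_le (a0 : σ → k) (A : σ → τ → k) (f : MvPolynomial σ k) :
    wsComplexity (aeval (SkewSubst.psi a0 A) f) ≤
      (skewComplexity f + Fintype.card σ) * (2 * Fintype.card τ + 3) :=
  (HI16Skew.wsComplexity_le_skewComplexity _).trans (skewComplexity_aeval_affine_le a0 A f)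

/-- `linSubst` is the affine substitution with `a = 0`, `A_{v,t} = B_{t,v}`.
[cite: MulmuleySohoni2001, §4] -/
theorem linSubst_eq_aeval_psi {k : Type*} [CommRing k] {σ : Type*} [Fintype σ]
    (B : Matrix σ σ k) (f : MvPolynomial σ k) :
    linSubst σ k B f = aeval (SkewSubst.psi (fun _ => (0 : k)) fun v t => B t v) f := by
  have h : (SkewSubst.psi (fun _ => (0 : k)) fun v t => B t v) = fun i => ∑ j, B j i • X j := by
    funext v
    simp [SkewSubst.psi]
  rw [h]
  rfl

/-- **`L_ws(B · f) ≤ (L_skew(f) + #σ)(2 #σ + 3)`** for every square matrix `B` (linear substitution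
of variables). [cite: BurgisserEtAl2011, Prop. 9.3.2 (proof, first direction)] -/
theorem wsComplexity_linSubst_le {k : Type*} [CommRing k] {σ : Type*} [Fintype σ] [DecidableEq σ]
    (B : Matrix σ σ k) (f : MvPolynomial σ k) :
    wsComplexity (linSubst σ k B f) ≤
      (skewComplexity f + Fintype.card σ) * (2 * Fintype.card σ + 3) := by
  rw [linSubst_eq_aeval_psi]
  exact wsComplexity_aeval_affine_le _ _ f

/-- **`L_skew(det_n) ≤ (n+2)(4n³+7)²`** (the tree's det circuit of
`HI16Skew.exists_wsCircuit_detPoly_wellFormed` is skew and well formed; corrected notion).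
[cite: BurgisserEtAl2011, §9.1 (i)] -/
theorem skewComplexity_detPoly_le (k : Type*) [CommRing k] (n : ℕ) :
    skewComplexity (detPoly (Fin n) k) ≤ (n + 2) * (4 * n ^ 3 + 7) ^ 2 := by
  obtain ⟨P, hwf, h2, _, hsk, _, hev, hsz⟩ := HI16Skew.exists_wsCircuit_detPoly_wellFormed k n
  exact (skewComplexity_le_size (f := detPoly (Fin n) k) P hwf h2 hsk hev).trans hsz

/-- **BLMW 2011, proof of Prop. 9.3.2: every linear-substitution instance `B · det_M` of the
determinant has a weakly-skew circuit of size polynomial in `M`** ("Composing this circuit with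
an arithmetic circuit for matrix vector multiplication … yields a weakly-skew arithmetic circuit
for `f_k` of size at most `m^{c'}`"): `L_ws(B · det_M) ≤ ((M+2)(4M³+7)² + M²)(2M² + 3)`.
[cite: BurgisserEtAl2011, Prop. 9.3.2 (proof, first direction)] -/
theorem wsComplexity_linSubst_detPoly_le (k : Type*) [CommRing k] (M : ℕ)
    (B : Matrix (Fin M × Fin M) (Fin M × Fin M) k) :
    wsComplexity (linSubst (Fin M × Fin M) k B (detPoly (Fin M) k)) ≤
      ((M + 2) * (4 * M ^ 3 + 7) ^ 2 + M * M) * (2 * (M * M) + 3) := by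
  refine (wsComplexity_linSubst_le B _).trans ?_
  have h := skewComplexity_detPoly_le k M
  have hc : Fintype.card (Fin M × Fin M) = M * M := by simp
  rw [hc]
  exact Nat.mul_le_mul_right _ (Nat.add_le_add_right h _)

end Bounds

end Literature.Computability.AlgebraicComplexity

end
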